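import Summits.Ventures.QEC.Census.CertCoverBatch
import Summits.Ventures.QEC.Census.TwoBGA.TB_l6m24_A0_0_0_1_3_11_B0_0_1_11_5_4.CoreDefs
import HarnessLib

set_option Elab.async false
set_option maxRecDepth 200000

/-!
# `[[288,12,16]]` one-level cover certificate of `TB_l6m24_A0_0_0_1_3_11_B0_0_1_11_5_4` — LEVEL-1→0 coset problems 6…16 (deep problems [5] excluded: `ProbDeep*.lean`) as COMPACT data
(`ProbData`: U, f, σ, y₀, allow; qec-type-10 `CertCoverBatch.mkCoset` rebuilds each `CosetProb` in the kernel) + their verdict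
`probsOK cov covR hx hx1 D1 lxd 14` (one `decide +kernel`; 11 problems, depths f=0:6 f=1:4 f=2:1 f=3:0, est. 93.0 s).
qec-search-1 g5 (pattern of search-9 g5 `Probs*`); data from JSON `level10.problems` (sha256 fee0559d1bce5e88…). Data + decided check; KERNEL.
-/

namespace Summit.Ventures.QEC.Census.TB_l6m24_A0_0_0_1_3_11_B0_0_1_11_5_4

open Matrix Summit.Ventures.QEC.Census Literature.InformationTheory.QuantumCodes

/-- Problems 6…16 (11): `⟨U, f, σ, y₀, allow⟩`. -/
def probs01 : List ProbData := [
    ⟨973555665815709284055368227883009, 2, 2305843146653698048, 973555665810986917572498582669312, [0, 9671406556917033397649408]⟩,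
    ⟨1622592773170341957715288594581505, 0, 2738188711082592264, 1622592773127840371139085501728768, [0]⟩,
    ⟨1622592775552776785071540839646210, 0, 3548800477845846491138, 1622592775545693163289642300343296, [0]⟩,
    ⟨1622592777991881451374384597958659, 0, 4827859212960794628, 28334343012406014246915, [0]⟩,
    ⟨1622592782813416333347462171854850, 1, 6917529302522134528, 14167099448608935641090, [0]⟩,
    ⟨2271629875642048408663523671932930, 1, 7133702084736581636, 1298074214652601128865309235609600, [0]⟩,
    ⟨2271629875693999628122410526441476, 0, 14915922516116504596, 85003317267594328670212, [0]⟩,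
    ⟨2271629880454143169356880384886787, 0, 4611686430746347520, 2271629880444698436391141094459392, [0]⟩,
    ⟨2271629890153877295872755173427200, 1, 432345564428894216, 2271629890116098075779421725788160, [0]⟩,
    ⟨2920666990200655403338792287077380, 0, 3555718007148368625666, 21250721230507474944004, [0]⟩,
    ⟨2920666997461294951614713619286020, 1, 13835058605044269056, 28334198897217871282180, [0]⟩]

set_option maxHeartbeats 400000000 in
/-- Every problem of this chunk passes (`mkCoset` elimination + `cosetOKD` + fast `σ` + depth + `BU`-evenness + label checks). -/
theorem probs01_ok : probsOK TB_l6m24_A0_0_0_1_3_11_B0_0_1_11_5_4.cov covR hx hx1 D1 lxd 14 probs01 = true := by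
  decide +kernel

/-- Pointwise form. -/
theorem probs01_all : ∀ x ∈ TB_l6m24_A0_0_0_1_3_11_B0_0_1_11_5_4.probs01, probOK cov covR hx hx1 D1 lxd 14 x = true := by
  have h := probs01_ok
  rwa [probsOK, List.all_eq_true] at h

end Summit.Ventures.QEC.Census.TB_l6m24_A0_0_0_1_3_11_B0_0_1_11_5_4
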